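import Summits.Ventures.CertifiedManyBodySolver.Certificates.HubbardSquare_transportClosure_KitN
import HarnessLib

/-!
# Ventures/CertifiedManyBodySolver — Certificates/HubbardSquare_transportClosure_KitN2.lean
# (hubbard-fast-reuse-1 g2, cell hubbard-fast, D-0154 (A) CERTIFICATE REUSE: the TRANSPORT-CLOSURE kit, part 5 = OUTWARD density-secant FLOORS)

Two more generic one-step TRANSPORT adapters in the shape of `HubbardSquare_transportClosure_KitLaws` (surrogate-1
`_mlword_Icc` contract, `θ = ![U/t, t'/t, n]`, floor/cap = 8 literal coefficients): the OUTWARD density-secant FLOORS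
(convexity of `n ↦ e₀`; the tree's point laws `energyDensityTT'_ge_density_extrapolate_left/right`,
`HubbardNNNHoppingEnergyDensityRegionBounds` §5). `KitLaws.tc_mlCap_nchord` is the INWARD use of convexity in `n`
(a cap between two caps); `KitN.tc_mlFloor_nVacuumSecx` is the outward floor through the vacuum `(0, 0)`; this file is the
general outward floor: from a bilinear FLOOR slice `A(U,s) ≤ e(·,·,n₁)` and a bilinear CAP slice `e(·,·,n₀) ≤ B(U,s)` at a
second density `n₀`, the chord through `(n₀, B)` and `(n₁, A)` extended BEYOND `n₁` (away from `n₀`) lies below `e₀`: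
* `tc_mlFloor_nsecxL` — `n₁ < n₀`, target densities `θ2 ≤ n₁`: `e(θ) ≥ A + (A − B)(n₁ − θ2)/(n₀ − n₁)`;
* `tc_mlFloor_nsecxR` — `n₀ < n₁`, target densities `θ2 ≥ n₁`: `e(θ) ≥ A + (A − B)(θ2 − n₁)/(n₁ − n₀)`.
Both right-hand sides are trilinear in `(θ0, θ1, θ2)`, so a literal 8-coefficient floor below them at the eight vertices of
the target cell is a floor on the cell (vertex rule `trilinear_nonneg_on_Icc₃`). Use (reuse-1 g2's generator `emit_tc2`, law
tags `nsecxL` / `nsecxR`): floors just OUTSIDE the density range of a box's words — e.g. the `n = 0.99` face of an `n ≈ 1`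
box from the floor at `n = 1` and a cap at `n = 1.01` (surr-3 g2's CLOSURE v3 located exactly this on M58 «Ca₂CuO₂Cl₂»).
HONEST FRAMING: bookkeeping adapters; they certify nothing by themselves; every consumer word inherits exactly the hypotheses
of the words it cites; no number of record; not a phase word; no summit statement is proved here; not a superconductivity verdict.
-/

namespace Summit.Ventures.CertifiedManyBodySolver.Certificates

open Literature.MathematicalPhysics.QuantumLattice
open Literature.MathematicalPhysics.QuantumLattice.ThermodynamicLimit
open Set

/-- **OUTWARD DENSITY-SECANT FLOOR, to LOWER densities** (convexity of `e₀` in `n`): a bilinear floor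
`A(U,s) ≤ e(t,s,U,n₁)` and a bilinear cap `e(t,s,U,n₀) ≤ B(U,s)` with `n₁ < n₀ < 2` on `U ∈ [Ua,Ub]` (`Ua ≥ 0`), `s ∈ [s₁,s₂]`
give, for `0 ≤ na ≤ θ2 ≤ nb ≤ n₁`, `e(θ) ≥ A + (A − B)(n₁ − θ2)/(n₀ − n₁)`; a literal trilinear form below that bound at the
eight vertices of the target cell is a floor on the cell. [cite: Ruelle1969, §3.3] -/
theorem tc_mlFloor_nsecxL (t : ℝ) {n₀ n₁ Ua Ub s₁ s₂ na nb α₀ α₁ α₂ α₃ β₀ β₁ β₂ β₃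
    c₀ c₁ c₂ c₃ c₄ c₅ c₆ c₇ : ℝ}
    (hUa : 0 ≤ Ua) (hna : 0 ≤ na) (hb : nb ≤ n₁) (hn : n₁ < n₀) (hn₀ : n₀ < 2)
    (hA : ∀ U s : ℝ, Ua ≤ U → U ≤ Ub → s₁ ≤ s → s ≤ s₂ →
      α₀ + α₁ * U + α₂ * s + α₃ * U * s ≤ energyDensityTT' t s U n₁)
    (hB : ∀ U s : ℝ, Ua ≤ U → U ≤ Ub → s₁ ≤ s → s ≤ s₂ →
      energyDensityTT' t s U n₀ ≤ β₀ + β₁ * U + β₂ * s + β₃ * U * s)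
    (v₁₁₁ : (n₀ - n₁) * (c₀ + c₁ * Ua + c₂ * s₁ + c₃ * na + c₄ * Ua * s₁ + c₅ * Ua * na + c₆ * s₁ * na + c₇ * Ua * s₁ * na) ≤
      (n₀ - n₁) * (α₀ + α₁ * Ua + α₂ * s₁ + α₃ * Ua * s₁) + ((α₀ + α₁ * Ua + α₂ * s₁ + α₃ * Ua * s₁) - (β₀ + β₁ * Ua + β₂ * s₁ + β₃ * Ua * s₁)) * (n₁ - na))
    (v₁₁₂ : (n₀ - n₁) * (c₀ + c₁ * Ua + c₂ * s₁ + c₃ * nb + c₄ * Ua * s₁ + c₅ * Ua * nb + c₆ * s₁ * nb + c₇ * Ua * s₁ * nb) ≤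
      (n₀ - n₁) * (α₀ + α₁ * Ua + α₂ * s₁ + α₃ * Ua * s₁) + ((α₀ + α₁ * Ua + α₂ * s₁ + α₃ * Ua * s₁) - (β₀ + β₁ * Ua + β₂ * s₁ + β₃ * Ua * s₁)) * (n₁ - nb))
    (v₁₂₁ : (n₀ - n₁) * (c₀ + c₁ * Ua + c₂ * s₂ + c₃ * na + c₄ * Ua * s₂ + c₅ * Ua * na + c₆ * s₂ * na + c₇ * Ua * s₂ * na) ≤
      (n₀ - n₁) * (α₀ + α₁ * Ua + α₂ * s₂ + α₃ * Ua * s₂) + ((α₀ + α₁ * Ua + α₂ * s₂ + α₃ * Ua * s₂) - (β₀ + β₁ * Ua + β₂ * s₂ + β₃ * Ua * s₂)) * (n₁ - na))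
    (v₁₂₂ : (n₀ - n₁) * (c₀ + c₁ * Ua + c₂ * s₂ + c₃ * nb + c₄ * Ua * s₂ + c₅ * Ua * nb + c₆ * s₂ * nb + c₇ * Ua * s₂ * nb) ≤
      (n₀ - n₁) * (α₀ + α₁ * Ua + α₂ * s₂ + α₃ * Ua * s₂) + ((α₀ + α₁ * Ua + α₂ * s₂ + α₃ * Ua * s₂) - (β₀ + β₁ * Ua + β₂ * s₂ + β₃ * Ua * s₂)) * (n₁ - nb))
    (v₂₁₁ : (n₀ - n₁) * (c₀ + c₁ * Ub + c₂ * s₁ + c₃ * na + c₄ * Ub * s₁ + c₅ * Ub * na + c₆ * s₁ * na + c₇ * Ub * s₁ * na) ≤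
      (n₀ - n₁) * (α₀ + α₁ * Ub + α₂ * s₁ + α₃ * Ub * s₁) + ((α₀ + α₁ * Ub + α₂ * s₁ + α₃ * Ub * s₁) - (β₀ + β₁ * Ub + β₂ * s₁ + β₃ * Ub * s₁)) * (n₁ - na))
    (v₂₁₂ : (n₀ - n₁) * (c₀ + c₁ * Ub + c₂ * s₁ + c₃ * nb + c₄ * Ub * s₁ + c₅ * Ub * nb + c₆ * s₁ * nb + c₇ * Ub * s₁ * nb) ≤
      (n₀ - n₁) * (α₀ + α₁ * Ub + α₂ * s₁ + α₃ * Ub * s₁) + ((α₀ + α₁ * Ub + α₂ * s₁ + α₃ * Ub * s₁) - (β₀ + β₁ * Ub + β₂ * s₁ + β₃ * Ub * s₁)) * (n₁ - nb))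
    (v₂₂₁ : (n₀ - n₁) * (c₀ + c₁ * Ub + c₂ * s₂ + c₃ * na + c₄ * Ub * s₂ + c₅ * Ub * na + c₆ * s₂ * na + c₇ * Ub * s₂ * na) ≤
      (n₀ - n₁) * (α₀ + α₁ * Ub + α₂ * s₂ + α₃ * Ub * s₂) + ((α₀ + α₁ * Ub + α₂ * s₂ + α₃ * Ub * s₂) - (β₀ + β₁ * Ub + β₂ * s₂ + β₃ * Ub * s₂)) * (n₁ - na))
    (v₂₂₂ : (n₀ - n₁) * (c₀ + c₁ * Ub + c₂ * s₂ + c₃ * nb + c₄ * Ub * s₂ + c₅ * Ub * nb + c₆ * s₂ * nb + c₇ * Ub * s₂ * nb) ≤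
      (n₀ - n₁) * (α₀ + α₁ * Ub + α₂ * s₂ + α₃ * Ub * s₂) + ((α₀ + α₁ * Ub + α₂ * s₂ + α₃ * Ub * s₂) - (β₀ + β₁ * Ub + β₂ * s₂ + β₃ * Ub * s₂)) * (n₁ - nb)) :
    ∀ θ ∈ Set.Icc (![Ua, s₁, na] : Fin 3 → ℝ) ![Ub, s₂, nb],
      c₀ + c₁ * θ 0 + c₂ * θ 1 + c₃ * θ 2 + c₄ * θ 0 * θ 1 + c₅ * θ 0 * θ 2 + c₆ * θ 1 * θ 2 +
        c₇ * θ 0 * θ 1 * θ 2 ≤ energyDensityTT' t (θ 1) (θ 0) (θ 2) := by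
  intro θ hθ
  obtain ⟨⟨k1, k2⟩, ⟨k3, k4⟩, ⟨k5, k6⟩⟩ := mem_Icc_vec3_iff.1 hθ
  have hU0 : 0 ≤ θ 0 := hUa.trans k1
  have hA' := hA (θ 0) (θ 1) k1 k2 k3 k4
  have hB' := hB (θ 0) (θ 1) k1 k2 k3 k4
  have hd : 0 < (n₀ - n₁) := by linarith
  -- the target form is below the (trilinear) extrapolated chord on the whole cell
  have hv := trilinear_nonneg_on_Icc₃ (a₀ := Ua) (a₁ := s₁) (a₂ := na) (b₀ := Ub) (b₁ := s₂) (b₂ := nb)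
    (c₀ := (n₀ - n₁) * α₀ + n₁ * (α₀ - β₀) - (n₀ - n₁) * c₀) (c₁ := (n₀ - n₁) * α₁ + n₁ * (α₁ - β₁) - (n₀ - n₁) * c₁)
    (c₂ := (n₀ - n₁) * α₂ + n₁ * (α₂ - β₂) - (n₀ - n₁) * c₂) (c₃ := -(α₀ - β₀) - (n₀ - n₁) * c₃)
    (c₄ := (n₀ - n₁) * α₃ + n₁ * (α₃ - β₃) - (n₀ - n₁) * c₄) (c₅ := -(α₁ - β₁) - (n₀ - n₁) * c₅)
    (c₆ := -(α₂ - β₂) - (n₀ - n₁) * c₆) (c₇ := -(α₃ - β₃) - (n₀ - n₁) * c₇)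
    (by linear_combination v₁₁₁) (by linear_combination v₁₁₂) (by linear_combination v₁₂₁)
    (by linear_combination v₁₂₂) (by linear_combination v₂₁₁) (by linear_combination v₂₁₂)
    (by linear_combination v₂₂₁) (by linear_combination v₂₂₂) θ hθ
  -- the extrapolated chord is below `e₀`
  have hch : (n₀ - n₁) * (α₀ + α₁ * θ 0 + α₂ * θ 1 + α₃ * θ 0 * θ 1) +
      ((α₀ + α₁ * θ 0 + α₂ * θ 1 + α₃ * θ 0 * θ 1) - (β₀ + β₁ * θ 0 + β₂ * θ 1 + β₃ * θ 0 * θ 1)) * (n₁ - θ 2) ≤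
      (n₀ - n₁) * energyDensityTT' t (θ 1) (θ 0) (θ 2) := by
    rcases eq_or_lt_of_le (k6.trans hb) with h0 | h0
    · rw [h0]
      have h1 := mul_le_mul_of_nonneg_left hA' hd.le
      linear_combination h1
    · have h := energyDensityTT'_ge_density_extrapolate_left t (θ 1) hU0 (n := θ 2) (n₁ := n₁) (n₀ := n₀)
        (R₀ := β₀ + β₁ * θ 0 + β₂ * θ 1 + β₃ * θ 0 * θ 1) (L₁ := α₀ + α₁ * θ 0 + α₂ * θ 1 + α₃ * θ 0 * θ 1)
        (hna.trans k5) h0 hn hn₀ hB' hA'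
      have h1 : ((α₀ + α₁ * θ 0 + α₂ * θ 1 + α₃ * θ 0 * θ 1) - (β₀ + β₁ * θ 0 + β₂ * θ 1 + β₃ * θ 0 * θ 1)) *
          (n₁ - θ 2) / (n₀ - n₁) ≤ energyDensityTT' t (θ 1) (θ 0) (θ 2) -
          (α₀ + α₁ * θ 0 + α₂ * θ 1 + α₃ * θ 0 * θ 1) := by linarith
      rw [div_le_iff₀ hd] at h1
      linear_combination h1
  have h3 : (n₀ - n₁) * (c₀ + c₁ * θ 0 + c₂ * θ 1 + c₃ * θ 2 + c₄ * θ 0 * θ 1 + c₅ * θ 0 * θ 2 +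
      c₆ * θ 1 * θ 2 + c₇ * θ 0 * θ 1 * θ 2) ≤ (n₀ - n₁) * energyDensityTT' t (θ 1) (θ 0) (θ 2) := by
    linear_combination hch + hv
  exact le_of_mul_le_mul_left h3 hd

/-- **OUTWARD DENSITY-SECANT FLOOR, to HIGHER densities** (convexity of `e₀` in `n`): a bilinear floor
`A(U,s) ≤ e(t,s,U,n₁)` and a bilinear cap `e(t,s,U,n₀) ≤ B(U,s)` with `0 ≤ n₀ < n₁` on `U ∈ [Ua,Ub]` (`Ua ≥ 0`), `s ∈ [s₁,s₂]`
give, for `n₁ ≤ na ≤ θ2 ≤ nb < 2`, `e(θ) ≥ A + (A − B)(θ2 − n₁)/(n₁ − n₀)`; a literal trilinear form below that bound at the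
eight vertices of the target cell is a floor on the cell. [cite: Ruelle1969, §3.3] -/
theorem tc_mlFloor_nsecxR (t : ℝ) {n₀ n₁ Ua Ub s₁ s₂ na nb α₀ α₁ α₂ α₃ β₀ β₁ β₂ β₃
    c₀ c₁ c₂ c₃ c₄ c₅ c₆ c₇ : ℝ}
    (hUa : 0 ≤ Ua) (hn₀ : 0 ≤ n₀) (hn : n₀ < n₁) (ha : n₁ ≤ na) (hnb : nb < 2)
    (hA : ∀ U s : ℝ, Ua ≤ U → U ≤ Ub → s₁ ≤ s → s ≤ s₂ →
      α₀ + α₁ * U + α₂ * s + α₃ * U * s ≤ energyDensityTT' t s U n₁)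
    (hB : ∀ U s : ℝ, Ua ≤ U → U ≤ Ub → s₁ ≤ s → s ≤ s₂ →
      energyDensityTT' t s U n₀ ≤ β₀ + β₁ * U + β₂ * s + β₃ * U * s)
    (v₁₁₁ : (n₁ - n₀) * (c₀ + c₁ * Ua + c₂ * s₁ + c₃ * na + c₄ * Ua * s₁ + c₅ * Ua * na + c₆ * s₁ * na + c₇ * Ua * s₁ * na) ≤
      (n₁ - n₀) * (α₀ + α₁ * Ua + α₂ * s₁ + α₃ * Ua * s₁) + ((α₀ + α₁ * Ua + α₂ * s₁ + α₃ * Ua * s₁) - (β₀ + β₁ * Ua + β₂ * s₁ + β₃ * Ua * s₁)) * (na - n₁))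
    (v₁₁₂ : (n₁ - n₀) * (c₀ + c₁ * Ua + c₂ * s₁ + c₃ * nb + c₄ * Ua * s₁ + c₅ * Ua * nb + c₆ * s₁ * nb + c₇ * Ua * s₁ * nb) ≤
      (n₁ - n₀) * (α₀ + α₁ * Ua + α₂ * s₁ + α₃ * Ua * s₁) + ((α₀ + α₁ * Ua + α₂ * s₁ + α₃ * Ua * s₁) - (β₀ + β₁ * Ua + β₂ * s₁ + β₃ * Ua * s₁)) * (nb - n₁))
    (v₁₂₁ : (n₁ - n₀) * (c₀ + c₁ * Ua + c₂ * s₂ + c₃ * na + c₄ * Ua * s₂ + c₅ * Ua * na + c₆ * s₂ * na + c₇ * Ua * s₂ * na) ≤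
      (n₁ - n₀) * (α₀ + α₁ * Ua + α₂ * s₂ + α₃ * Ua * s₂) + ((α₀ + α₁ * Ua + α₂ * s₂ + α₃ * Ua * s₂) - (β₀ + β₁ * Ua + β₂ * s₂ + β₃ * Ua * s₂)) * (na - n₁))
    (v₁₂₂ : (n₁ - n₀) * (c₀ + c₁ * Ua + c₂ * s₂ + c₃ * nb + c₄ * Ua * s₂ + c₅ * Ua * nb + c₆ * s₂ * nb + c₇ * Ua * s₂ * nb) ≤
      (n₁ - n₀) * (α₀ + α₁ * Ua + α₂ * s₂ + α₃ * Ua * s₂) + ((α₀ + α₁ * Ua + α₂ * s₂ + α₃ * Ua * s₂) - (β₀ + β₁ * Ua + β₂ * s₂ + β₃ * Ua * s₂)) * (nb - n₁))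
    (v₂₁₁ : (n₁ - n₀) * (c₀ + c₁ * Ub + c₂ * s₁ + c₃ * na + c₄ * Ub * s₁ + c₅ * Ub * na + c₆ * s₁ * na + c₇ * Ub * s₁ * na) ≤
      (n₁ - n₀) * (α₀ + α₁ * Ub + α₂ * s₁ + α₃ * Ub * s₁) + ((α₀ + α₁ * Ub + α₂ * s₁ + α₃ * Ub * s₁) - (β₀ + β₁ * Ub + β₂ * s₁ + β₃ * Ub * s₁)) * (na - n₁))
    (v₂₁₂ : (n₁ - n₀) * (c₀ + c₁ * Ub + c₂ * s₁ + c₃ * nb + c₄ * Ub * s₁ + c₅ * Ub * nb + c₆ * s₁ * nb + c₇ * Ub * s₁ * nb) ≤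
      (n₁ - n₀) * (α₀ + α₁ * Ub + α₂ * s₁ + α₃ * Ub * s₁) + ((α₀ + α₁ * Ub + α₂ * s₁ + α₃ * Ub * s₁) - (β₀ + β₁ * Ub + β₂ * s₁ + β₃ * Ub * s₁)) * (nb - n₁))
    (v₂₂₁ : (n₁ - n₀) * (c₀ + c₁ * Ub + c₂ * s₂ + c₃ * na + c₄ * Ub * s₂ + c₅ * Ub * na + c₆ * s₂ * na + c₇ * Ub * s₂ * na) ≤
      (n₁ - n₀) * (α₀ + α₁ * Ub + α₂ * s₂ + α₃ * Ub * s₂) + ((α₀ + α₁ * Ub + α₂ * s₂ + α₃ * Ub * s₂) - (β₀ + β₁ * Ub + β₂ * s₂ + β₃ * Ub * s₂)) * (na - n₁))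
    (v₂₂₂ : (n₁ - n₀) * (c₀ + c₁ * Ub + c₂ * s₂ + c₃ * nb + c₄ * Ub * s₂ + c₅ * Ub * nb + c₆ * s₂ * nb + c₇ * Ub * s₂ * nb) ≤
      (n₁ - n₀) * (α₀ + α₁ * Ub + α₂ * s₂ + α₃ * Ub * s₂) + ((α₀ + α₁ * Ub + α₂ * s₂ + α₃ * Ub * s₂) - (β₀ + β₁ * Ub + β₂ * s₂ + β₃ * Ub * s₂)) * (nb - n₁)) :
    ∀ θ ∈ Set.Icc (![Ua, s₁, na] : Fin 3 → ℝ) ![Ub, s₂, nb],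
      c₀ + c₁ * θ 0 + c₂ * θ 1 + c₃ * θ 2 + c₄ * θ 0 * θ 1 + c₅ * θ 0 * θ 2 + c₆ * θ 1 * θ 2 +
        c₇ * θ 0 * θ 1 * θ 2 ≤ energyDensityTT' t (θ 1) (θ 0) (θ 2) := by
  intro θ hθ
  obtain ⟨⟨k1, k2⟩, ⟨k3, k4⟩, ⟨k5, k6⟩⟩ := mem_Icc_vec3_iff.1 hθ
  have hU0 : 0 ≤ θ 0 := hUa.trans k1
  have hA' := hA (θ 0) (θ 1) k1 k2 k3 k4
  have hB' := hB (θ 0) (θ 1) k1 k2 k3 k4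
  have hd : 0 < (n₁ - n₀) := by linarith
  have hn2 : θ 2 < 2 := lt_of_le_of_lt k6 hnb
  have hv := trilinear_nonneg_on_Icc₃ (a₀ := Ua) (a₁ := s₁) (a₂ := na) (b₀ := Ub) (b₁ := s₂) (b₂ := nb)
    (c₀ := (n₁ - n₀) * α₀ - n₁ * (α₀ - β₀) - (n₁ - n₀) * c₀) (c₁ := (n₁ - n₀) * α₁ - n₁ * (α₁ - β₁) - (n₁ - n₀) * c₁)
    (c₂ := (n₁ - n₀) * α₂ - n₁ * (α₂ - β₂) - (n₁ - n₀) * c₂) (c₃ := (α₀ - β₀) - (n₁ - n₀) * c₃)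
    (c₄ := (n₁ - n₀) * α₃ - n₁ * (α₃ - β₃) - (n₁ - n₀) * c₄) (c₅ := (α₁ - β₁) - (n₁ - n₀) * c₅)
    (c₆ := (α₂ - β₂) - (n₁ - n₀) * c₆) (c₇ := (α₃ - β₃) - (n₁ - n₀) * c₇)
    (by linear_combination v₁₁₁) (by linear_combination v₁₁₂) (by linear_combination v₁₂₁)
    (by linear_combination v₁₂₂) (by linear_combination v₂₁₁) (by linear_combination v₂₁₂)
    (by linear_combination v₂₂₁) (by linear_combination v₂₂₂) θ hθ
  have hch : (n₁ - n₀) * (α₀ + α₁ * θ 0 + α₂ * θ 1 + α₃ * θ 0 * θ 1) +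
      ((α₀ + α₁ * θ 0 + α₂ * θ 1 + α₃ * θ 0 * θ 1) - (β₀ + β₁ * θ 0 + β₂ * θ 1 + β₃ * θ 0 * θ 1)) * (θ 2 - n₁) ≤
      (n₁ - n₀) * energyDensityTT' t (θ 1) (θ 0) (θ 2) := by
    rcases eq_or_lt_of_le (ha.trans k5) with h0 | h0
    · rw [← h0]
      have h1 := mul_le_mul_of_nonneg_left hA' hd.le
      linear_combination h1
    · have h := energyDensityTT'_ge_density_extrapolate_right t (θ 1) hU0 (n₀ := n₀) (n₁ := n₁) (n := θ 2)
        (R₀ := β₀ + β₁ * θ 0 + β₂ * θ 1 + β₃ * θ 0 * θ 1) (L₁ := α₀ + α₁ * θ 0 + α₂ * θ 1 + α₃ * θ 0 * θ 1)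
        hn₀ hn h0 hn2 hB' hA'
      have h1 : ((α₀ + α₁ * θ 0 + α₂ * θ 1 + α₃ * θ 0 * θ 1) - (β₀ + β₁ * θ 0 + β₂ * θ 1 + β₃ * θ 0 * θ 1)) *
          (θ 2 - n₁) / (n₁ - n₀) ≤ energyDensityTT' t (θ 1) (θ 0) (θ 2) -
          (α₀ + α₁ * θ 0 + α₂ * θ 1 + α₃ * θ 0 * θ 1) := by linarith
      rw [div_le_iff₀ hd] at h1
      linear_combination h1
  have h3 : (n₁ - n₀) * (c₀ + c₁ * θ 0 + c₂ * θ 1 + c₃ * θ 2 + c₄ * θ 0 * θ 1 + c₅ * θ 0 * θ 2 +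
      c₆ * θ 1 * θ 2 + c₇ * θ 0 * θ 1 * θ 2) ≤ (n₁ - n₀) * energyDensityTT' t (θ 1) (θ 0) (θ 2) := by
    linear_combination hch + hv
  exact le_of_mul_le_mul_left h3 hd

end Summit.Ventures.CertifiedManyBodySolver.Certificates
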